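import Summits.Ventures.CertifiedArithmetic.LowPrec.SRTreeHoeffding
import Summits.Ventures.CertifiedArithmetic.LowPrec.SRHoeffdingLimitedBits
import HarnessLib

/-!
# Limited-randomness SR on ARBITRARY summation trees (pairwise, blocked, any order), I: the model and
# the bias bound `≤ m ε G` (venture file LXX of the SR slice; the exponential envelope is file LXXI,
# `SRTreeLimitedBitsTail`)

HONEST FRAMING: certified error envelopes and provably optimal rounding/accumulation schemes for
low-precision formats under stated cost models; every table by two implementations; no hardware or
vendor claims.

`SRTree`/`SRTreeHoeffding` treat a sum evaluated in ANY order (a summation tree `T` with `m = T.nodes`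
roundings) under EXACT stochastic rounding; `SRLimitedBits`/`SRHoeffdingLimitedBits` treat RECURSIVE
summation under a rounding step whose away-probability is a perturbed function `q` of the exact one
(`|q η − η| ≤ ε` on `[0,1]`, `q([0,1]) ⊆ [0,1]`; the IEEE P3109 rules StochasticA/B/C with `N` random
bits are `q = probAwayA/B/C N` with `ε = 2^{-N}`, `2^{-(N+1)}`, `2^{-(N+1)}`).  This file is the common
generalisation: `treeExpQ F q T f = E[f(ŝ_T)]` when EVERY node of `T` rounds with the perturbed rule.

* `treeExpQ_of_id` / `treeExpQ_comb` — with exact probabilities it is `treeExp` (`SRTree`); on the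
  left comb it is the recursive model `accExpQ` (`SRLimitedBits`).
* `abs_treeExpQ_id_sub_exact_le` — **bias, any order**: `|E[ŝ_T] − ∑ leaves| ≤ m ε G` under
  `NoSatT ∧ GapLET G` (generic ordered field), and `stochasticA/B/C_tree_bias_le` — the three P3109
  rules (`ε = 2^{-N}, 2^{-(N+1)}, 2^{-(N+1)}`).  The mgf bound `e^{m (t²G²/8 + |t| ε G)}` and the shifted
  tail `P(|ŝ_T − ∑| ≥ t + m ε G) ≤ 2 e^{−2t²/(m G²)}` over `ℝ` are in `SRTreeLimitedBitsTail`.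

Placement.  El Arar–Fasi–Filip–Mikaitis, *Probabilistic error analysis of limited-precision stochastic
rounding* (arXiv:2603.24161, 2026), Thm. 2 bounds pairwise summation under `SR_{p,r}` (RN to `p + r`
bits, then `r` random bits) in the RELATIVE first-order model by a mean-independent martingale part
(their Lemma 1) plus a deterministic bias of first order `h·u_{p+r}·∑|aᵢ|`, `h` the height.  The
statements here are the finite-format, absolute-error counterpart for EVERY tree and every perturbed
rule: drift at most `ε G` per rounding on every branch, fluctuation with the exact-SR Hoeffding
envelope.  No claim beyond that; nothing here is a statement about the relative model.
-/

namespace Summit.Ventures.CertifiedArithmetic.LowPrec.SR.LimitedBits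

open Literature.ComputerArithmetic.P3109
open Literature.ComputerArithmetic.ConnollyHighamMary2021
open Summit.Ventures.CertifiedArithmetic.LowPrec.SR
open Finset Real STree

section Generic

variable {K : Type*} [Field K] [LinearOrder K] [IsStrictOrderedRing K]

/-! ### The model: every node rounds with the perturbed rule -/

/-- `treeExpQ F q T f = E[f(ŝ_T)]`: a leaf returns its summand exactly; a node evaluates its two
subtrees independently (values `a`, `b`) and returns a fresh perturbed-SR rounding (`stepQ F q`) of
`a + b` into `F`. -/
def treeExpQ (F : Finset K) (q : K → K) : STree K → (K → K) → K
  | .leaf x, f => f x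
  | .node l r, f => treeExpQ F q l (fun a => treeExpQ F q r (fun b => stepQ F q (a + b) f))

omit [IsStrictOrderedRing K] in
/-- `treeExpQ` respects pointwise equality of integrands. -/
theorem treeExpQ_congr (F : Finset K) (q : K → K) (T : STree K) {f g : K → K} (h : ∀ v, f v = g v) :
    treeExpQ F q T f = treeExpQ F q T g := by
  rw [show f = g from funext h]

omit [IsStrictOrderedRing K] in
/-- With the EXACT probabilities (`q = id`) one perturbed step is the exact SR step. -/
theorem stepQ_of_id (F : Finset K) {q : K → K} (hq : ∀ η, q η = η) (c : K) (f : K → K) :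
    stepQ F q c f = step F c f := by
  have hp : pUpQ F q c = pUp F c := by
    unfold pUpQ; split_ifs <;> simp [hq]
  unfold stepQ step; rw [hp]

omit [IsStrictOrderedRing K] in
/-- With the exact probabilities the model is the exact-SR tree model `treeExp` of `SRTree`. -/
theorem treeExpQ_of_id (F : Finset K) {q : K → K} (hq : ∀ η, q η = η) :
    ∀ (T : STree K) (f : K → K), treeExpQ F q T f = treeExp F T f
  | .leaf x, f => rfl
  | .node l r, f => by
      simp only [treeExpQ, treeExp]
      rw [treeExpQ_of_id F hq l]
      refine treeExp_congr F l (fun a => ?_)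
      rw [treeExpQ_of_id F hq r]
      exact treeExp_congr F r (fun b => stepQ_of_id F hq _ f)

omit [IsStrictOrderedRing K] in
/-- The recursive model, last step peeled off: `E[f(ŝₙ₊₁)] = E[(stepQ (ŝₙ + xₙ) f)]`. -/
theorem accExpQ_succ_last (F : Finset K) (q : K → K) :
    ∀ (n : ℕ) (x : ℕ → K) (f : K → K) (s : K),
      accExpQ F q x (n + 1) f s = accExpQ F q x n (fun a => stepQ F q (a + x n) f) s
  | 0, x, f, s => by simp [accExpQ]
  | n + 1, x, f, s => by
      have ih := accExpQ_succ_last F q n (fun i => x (i + 1)) f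
      show stepQ F q (s + x 0) (accExpQ F q (fun i => x (i + 1)) (n + 1) f)
        = stepQ F q (s + x 0) (accExpQ F q (fun i => x (i + 1)) n (fun a => stepQ F q (a + x (n + 1)) f))
      rw [show accExpQ F q (fun i => x (i + 1)) (n + 1) f
          = accExpQ F q (fun i => x (i + 1)) n (fun a => stepQ F q (a + x (n + 1)) f) from funext ih]

omit [IsStrictOrderedRing K] in
/-- **On the left comb the tree model is recursive summation**: `treeExpQ F q (comb x s n) f =
accExpQ F q x n f s` (so every statement of `SRLimitedBits`/`SRHoeffdingLimitedBits` is the comb case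
of this file). -/
theorem treeExpQ_comb (F : Finset K) (q : K → K) (x : ℕ → K) (s : K) :
    ∀ (n : ℕ) (f : K → K), treeExpQ F q (comb x s n) f = accExpQ F q x n f s
  | 0, f => rfl
  | n + 1, f => by
      show treeExpQ F q (comb x s n) (fun a => stepQ F q (a + x n) f) = accExpQ F q x (n + 1) f s
      rw [treeExpQ_comb F q x s n, accExpQ_succ_last]

/-! ### Linearity and monotonicity -/

omit [IsStrictOrderedRing K] in
/-- Total mass one. -/
theorem treeExpQ_const (F : Finset K) (q : K → K) :
    ∀ (T : STree K) (a : K), treeExpQ F q T (fun _ => a) = a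
  | .leaf x, a => rfl
  | .node l r, a => by
      simp only [treeExpQ]
      have h : (fun a' => treeExpQ F q r (fun b => stepQ F q (a' + b) (fun _ => a))) = fun _ => a := by
        funext a'
        rw [treeExpQ_congr F q r (g := fun _ => a) (fun b => stepQ_const F q _ a)]
        exact treeExpQ_const F q r a
      rw [h]; exact treeExpQ_const F q l a

omit [IsStrictOrderedRing K] in
/-- Additivity. -/
theorem treeExpQ_add (F : Finset K) (q : K → K) : ∀ (T : STree K) (f g : K → K),
    treeExpQ F q T (fun v => f v + g v) = treeExpQ F q T f + treeExpQ F q T g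
  | .leaf x, f, g => rfl
  | .node l r, f, g => by
      simp only [treeExpQ]
      rw [← treeExpQ_add F q l]
      refine treeExpQ_congr F q l (fun a => ?_)
      rw [← treeExpQ_add F q r]
      exact treeExpQ_congr F q r (fun b => stepQ_add F q _ f g)

omit [IsStrictOrderedRing K] in
/-- Scalars (generic field version of `stepQ_mul_left`). -/
theorem stepQ_const_mul (F : Finset K) (q : K → K) (c a : K) (f : K → K) :
    stepQ F q c (fun v => a * f v) = a * stepQ F q c f := by
  unfold stepQ; ring

omit [IsStrictOrderedRing K] in
/-- Scalars pull out of the tree model. -/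
theorem treeExpQ_mul_left (F : Finset K) (q : K → K) : ∀ (T : STree K) (a : K) (f : K → K),
    treeExpQ F q T (fun v => a * f v) = a * treeExpQ F q T f
  | .leaf x, a, f => rfl
  | .node l r, a, f => by
      simp only [treeExpQ]
      rw [← treeExpQ_mul_left F q l]
      refine treeExpQ_congr F q l (fun a' => ?_)
      rw [← treeExpQ_mul_left F q r]
      exact treeExpQ_congr F q r (fun b => stepQ_const_mul F q _ a f)

/-- Monotonicity of one perturbed step through its two leaves (generic field; `q([0,1]) ⊆ [0,1]`). -/
theorem stepQ_mono_leaves (F : Finset K) {q : K → K}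
    (hq01 : ∀ η, 0 ≤ η → η ≤ 1 → 0 ≤ q η ∧ q η ≤ 1) (c : K) {f g : K → K}
    (hu : f (up F c) ≤ g (up F c)) (hd : f (dn F c) ≤ g (dn F c)) :
    stepQ F q c f ≤ stepQ F q c g := by
  obtain ⟨hp0, hp1⟩ := pUpQ_mem F hq01 c
  unfold stepQ
  exact add_le_add (mul_le_mul_of_nonneg_left hu hp0)
    (mul_le_mul_of_nonneg_left hd (sub_nonneg.mpr hp1))

/-- Monotonicity ON THE SUPPORT (the outcome tree `AllOut` of `SRTree`: the perturbed rule has the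
same two candidates at every node). -/
theorem treeExpQ_mono_of_allOut (F : Finset K) {q : K → K}
    (hq01 : ∀ η, 0 ≤ η → η ≤ 1 → 0 ≤ q η ∧ q η ≤ 1) : ∀ (T : STree K) {f g : K → K},
    AllOut F T (fun v => f v ≤ g v) → treeExpQ F q T f ≤ treeExpQ F q T g
  | .leaf x, _, _, h => h
  | .node l r, _, _, h => by
      simp only [treeExpQ]
      refine treeExpQ_mono_of_allOut F hq01 l (allOut_mono F l (fun a ha => ?_) h)
      refine treeExpQ_mono_of_allOut F hq01 r (allOut_mono F r (fun b hb => ?_) ha)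
      exact stepQ_mono_leaves F hq01 _ hb.1 hb.2

/-- Monotonicity. -/
theorem treeExpQ_mono (F : Finset K) {q : K → K}
    (hq01 : ∀ η, 0 ≤ η → η ≤ 1 → 0 ≤ q η ∧ q η ≤ 1) (T : STree K) {f g : K → K}
    (h : ∀ v, f v ≤ g v) : treeExpQ F q T f ≤ treeExpQ F q T g :=
  treeExpQ_mono_of_allOut F hq01 T (allOut_of_forall F T h)

/-- An integrand with `|f| ≤ M` on the support has `|E f| ≤ M`. -/
theorem abs_treeExpQ_le_of_allOut (F : Finset K) {q : K → K}
    (hq01 : ∀ η, 0 ≤ η → η ≤ 1 → 0 ≤ q η ∧ q η ≤ 1) (T : STree K) {f : K → K} {M : K}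
    (h : AllOut F T (fun v => |f v| ≤ M)) : |treeExpQ F q T f| ≤ M := by
  rw [abs_le]
  constructor
  · have := treeExpQ_mono_of_allOut F hq01 T (f := fun _ => -M) (g := f)
      (allOut_mono F T (fun v hv => (abs_le.mp hv).1) h)
    rwa [treeExpQ_const] at this
  · have := treeExpQ_mono_of_allOut F hq01 T (f := f) (g := fun _ => M)
      (allOut_mono F T (fun v hv => (abs_le.mp hv).2) h)
    rwa [treeExpQ_const] at this

/-! ### Bias, any order -/

/-- **Bias of limited-randomness SR summation in ANY order.** If `q` maps `[0,1]` into `[0,1]` with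
`|q η − η| ≤ ε`, no node saturates on any branch (`NoSatT`) and every node's candidate gap is `≤ G`
(`GapLET`), then `|E[ŝ_T] − ∑ leaves| ≤ m · (ε G)`, `m = T.nodes`. -/
theorem abs_treeExpQ_id_sub_exact_le (F : Finset K) {q : K → K} {ε : K}
    (hq01 : ∀ η, 0 ≤ η → η ≤ 1 → 0 ≤ q η ∧ q η ≤ 1) (hq : ∀ η, 0 ≤ η → η ≤ 1 → |q η - η| ≤ ε)
    (G : K) : ∀ T : STree K, NoSatT F T → GapLET F G T →
      |treeExpQ F q T (fun v => v) - T.exact| ≤ T.nodes * (ε * G)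
  | .leaf x, _, _ => by simp [treeExpQ, STree.exact, STree.nodes]
  | .node l r, ⟨hl, hr, hh⟩, ⟨hgl, hgr, hg⟩ => by
      have ihl := abs_treeExpQ_id_sub_exact_le F hq01 hq G l hl hgl
      have ihr := abs_treeExpQ_id_sub_exact_le F hq01 hq G r hr hgr
      have hε : 0 ≤ ε := (abs_nonneg _).trans (hq 0 le_rfl zero_le_one)
      simp only [treeExpQ, STree.exact, STree.nodes]
      -- the node's own defect `d a b = E[stepQ(a+b)] − (a+b)`
      set d : K → K → K := fun a b => stepQ F q (a + b) (fun v => v) - (a + b) with hd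
      have inner : ∀ a, treeExpQ F q r (fun b => stepQ F q (a + b) (fun v => v))
          = a + treeExpQ F q r (fun v => v) + treeExpQ F q r (fun b => d a b) := by
        intro a
        have e : (fun b => stepQ F q (a + b) (fun v => v)) = fun b => (a + b) + d a b := by
          funext b; simp [hd]
        rw [e, treeExpQ_add, treeExpQ_add, treeExpQ_const]
      have outer : treeExpQ F q l (fun a => treeExpQ F q r (fun b => stepQ F q (a + b) (fun v => v)))
          = treeExpQ F q l (fun v => v) + treeExpQ F q r (fun v => v)
            + treeExpQ F q l (fun a => treeExpQ F q r (fun b => d a b)) := by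
        rw [treeExpQ_congr F q l inner, treeExpQ_add, treeExpQ_add, treeExpQ_const]
      -- the defect is at most `ε G` on every branch
      have hX : |treeExpQ F q l (fun a => treeExpQ F q r (fun b => d a b))| ≤ ε * G := by
        refine abs_treeExpQ_le_of_allOut F hq01 l (allOut_mono F l (fun a ha => ?_)
          (allOut_and F l hh hg))
        refine abs_treeExpQ_le_of_allOut F hq01 r (allOut_mono F r (fun b hb => ?_)
          (allOut_and F r ha.1 ha.2))
        have h1 := abs_stepQ_id_sub_le F hq (a + b)
        rw [clamp_eq_self hb.1] at h1
        have hg' : up F (a + b) - dn F (a + b) ≤ G := hb.2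
        exact h1.trans (mul_le_mul_of_nonneg_left hg' hε)
      rw [outer]
      calc |treeExpQ F q l (fun v => v) + treeExpQ F q r (fun v => v)
              + treeExpQ F q l (fun a => treeExpQ F q r (fun b => d a b)) - (l.exact + r.exact)|
          = |(treeExpQ F q l (fun v => v) - l.exact) + (treeExpQ F q r (fun v => v) - r.exact)
              + treeExpQ F q l (fun a => treeExpQ F q r (fun b => d a b))| := by ring_nf
        _ ≤ |treeExpQ F q l (fun v => v) - l.exact| + |treeExpQ F q r (fun v => v) - r.exact|
              + |treeExpQ F q l (fun a => treeExpQ F q r (fun b => d a b))| := abs_add_three _ _ _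
        _ ≤ l.nodes * (ε * G) + r.nodes * (ε * G) + ε * G := add_le_add (add_le_add ihl ihr) hX
        _ = ((l.nodes + r.nodes + 1 : ℕ) : K) * (ε * G) := by push_cast; ring

variable [FloorRing K]

/-- **StochasticA on any tree**: `|E[ŝ_T] − ∑ leaves| ≤ m·G·2^{-N}`. -/
theorem stochasticA_tree_bias_le (F : Finset K) (N : ℕ) (G : K) (T : STree K) (h : NoSatT F T)
    (hg : GapLET F G T) :
    |treeExpQ F (probAwayA N) T (fun v => v) - T.exact| ≤ T.nodes * (1 / 2 ^ N * G) :=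
  abs_treeExpQ_id_sub_exact_le F (probAwayA_mem N) (fun η _ _ => abs_probAwayA_sub_le N η) G T h hg

/-- **StochasticB on any tree**: `|E[ŝ_T] − ∑ leaves| ≤ m·G·2^{-(N+1)}`. -/
theorem stochasticB_tree_bias_le (F : Finset K) (N : ℕ) (G : K) (T : STree K) (h : NoSatT F T)
    (hg : GapLET F G T) :
    |treeExpQ F (probAwayB N) T (fun v => v) - T.exact| ≤ T.nodes * (1 / 2 ^ (N + 1) * G) :=
  abs_treeExpQ_id_sub_exact_le F (probAwayB_mem N) (fun η _ _ => abs_probAwayB_sub_le N η) G T h hg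

/-- **StochasticC on any tree**: `|E[ŝ_T] − ∑ leaves| ≤ m·G·2^{-(N+1)}`. -/
theorem stochasticC_tree_bias_le (F : Finset K) (N : ℕ) (G : K) (T : STree K) (h : NoSatT F T)
    (hg : GapLET F G T) :
    |treeExpQ F (probAwayC N) T (fun v => v) - T.exact| ≤ T.nodes * (1 / 2 ^ (N + 1) * G) :=
  abs_treeExpQ_id_sub_exact_le F (probAwayC_mem N) (fun η _ _ => abs_probAwayC_sub_le N η) G T h hg

end Generic

end Summit.Ventures.CertifiedArithmetic.LowPrec.SR.LimitedBits
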